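import Summits.NavierStokesRegularity.NavierStokesRegularity.Theorems.EfficiencyFloorNearSaturationNearMaximiserSeqCoreWeakProfile
import Summits.NavierStokesRegularity.NavierStokesRegularity.Theorems.ScenarioCensusRowD9DissipationTools
import HarnessLib

/-!
# Route `EfficiencyFloor`, crux `NearSaturationNearMaximiser` (stmt-NavierStokesRegularity-25482) on the
# `ProductionEfficiencyDecay` ladder (stmt-22866): the weak-class limit profile is a Sobolev function, unique up to constants

Def-free helper file, companion of `…SeqCoreWeakProfile`. The weak-class profile `w₀` of `exists_weakProfile` is given by the
vector-test-field identities `∫⟪w₀, ∂ⱼψ⟫ = −∫⟪M_j, ψ⟫`; this file bridges them to the tree's Sobolev vocabulary and draws the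
uniqueness consequence:

* `locallyIntegrable_of_memLp_weight_smul` — a field with `(1+|x|)^{-3/2} w ∈ L²` is locally integrable;
* `hasWeakGradient_of_weakProfile` — `w₀` has the WEAK GRADIENT `G(x) = Σⱼ ⟪eⱼ, ·⟫ M_j(x)` in the sense of
  `Literature.Analysis.FluidPDE.HasWeakGradient` (= `HasWeakFDerivOn ⊤ volume`, Evans §5.2.1): `w₀ ∈ W^{1,1}_{loc}` with
  `∇w₀ = (M_j) ∈ L²`;
* `weakProfile_unique_up_to_const` — two weak-class profiles with the same gradient data differ a.e. by a constant vector
  (`ScenarioCensus…ae_eq_const_of_hasWeakGradient_zero`: weak gradient zero ⇒ a.e. constant);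
* `lintegral_weight_sq_eq_top`, `eq_zero_of_memLp_weight_smul_const`, `weakProfile_unique` — `∫(1+|x|)^{-3} = ∞` on `ℝ³`
  (dyadic shells), so the constant is `0`: the weak-class profile is UNIQUE a.e. Consequently the by-name hypotheses (I'-reg),
  (I'-reg-H²) of `…SeqCoreProfileRegularity` / `…SeqCoreProfileVorticity` quantify over exactly one object — the Lu–Doering limit
  profile — and are equivalent to (I') of `…SeqCoreCurlLimit`.

HONEST FRAMING: nothing here proves stmt-25482, `LerayFloorGap`, `ProductionEfficiencyDecay` (stmt-22866) or
Navier–Stokes regularity; no summit statement is proved. [folklore]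
-/

-- the problem directory repeats the summit name (`NavierStokesRegularity/NavierStokesRegularity`)
set_option linter.dupNamespace false

noncomputable section

namespace Summit.NavierStokesRegularity.NavierStokesRegularity.Theorems

namespace NearSaturationNearMaximiser

namespace SeqCore

open Set MeasureTheory Filter Topology Function Real
open scoped InnerProductSpace ENNReal NNReal
open Literature.Analysis.FluidPDE
open Magsanop2026Enstrophy (slice_integrable)
open Metric

/-! ## §1 Local integrability of a weighted-`L²` field -/

/-- A measurable field with `(1+|x|)^{-3/2} w ∈ L²(ℝ³)` is locally integrable (the inverse weight is continuous). [folklore] -/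
theorem locallyIntegrable_of_memLp_weight_smul {w : EuclideanSpace ℝ (Fin 3) → EuclideanSpace ℝ (Fin 3)}
    (h2 : MemLp (fun x => ((1 : ℝ) + ‖x‖) ^ (-(3 / 2 : ℝ)) • w x) 2 volume) : LocallyIntegrable w volume := by
  have hli : LocallyIntegrable (fun x => ((1 : ℝ) + ‖x‖) ^ (-(3 / 2 : ℝ)) • w x) volume := h2.locallyIntegrable one_le_two
  have hinv : Continuous fun x : EuclideanSpace ℝ (Fin 3) => (((1 : ℝ) + ‖x‖) ^ (-(3 / 2 : ℝ)))⁻¹ :=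
    continuous_weight.inv₀ fun x => (weight_pos x).ne'
  have h := LocallyIntegrableOn.continuousOn_smul isOpen_univ.isLocallyClosed (hli.locallyIntegrableOn univ) hinv.continuousOn
  rw [locallyIntegrableOn_univ] at h
  refine h.congr (ae_of_all _ fun x => ?_)
  show (((1 : ℝ) + ‖x‖) ^ (-(3 / 2 : ℝ)))⁻¹ • (((1 : ℝ) + ‖x‖) ^ (-(3 / 2 : ℝ)) • w x) = w x
  rw [smul_smul, inv_mul_cancel₀ (weight_pos x).ne', one_smul]

/-! ## §2 The weak-class profile has a weak gradient -/

/-- **The weak-class profile is a Sobolev function**: if `(1+|x|)^{-3/2} w ∈ L²`, `M_j ∈ L²` and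
`∫⟪w, ∂ⱼψ⟫ = −∫⟪M_j, ψ⟫` for all `C¹` compactly supported vector test fields `ψ`, then `w` has the weak gradient
`G(x) v = Σⱼ ⟪eⱼ, v⟫ M_j(x)` on `ℝ³` (`HasWeakGradient`, Evans §5.2.1: scalar test functions, all directions). [folklore] -/
theorem hasWeakGradient_of_weakProfile {w : EuclideanSpace ℝ (Fin 3) → EuclideanSpace ℝ (Fin 3)}
    {M : Fin 3 → EuclideanSpace ℝ (Fin 3) → EuclideanSpace ℝ (Fin 3)}
    (h2 : MemLp (fun x => ((1 : ℝ) + ‖x‖) ^ (-(3 / 2 : ℝ)) • w x) 2 volume) (hM : ∀ j, MemLp (M j) 2 volume)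
    (hprof : ∀ (j : Fin 3) (ψ : EuclideanSpace ℝ (Fin 3) → EuclideanSpace ℝ (Fin 3)), ContDiff ℝ 1 ψ → HasCompactSupport ψ →
      ∫ x, ⟪w x, fderiv ℝ ψ x (EuclideanSpace.basisFun (Fin 3) ℝ j)⟫_ℝ = -∫ x, ⟪M j x, ψ x⟫_ℝ) :
    HasWeakGradient w (fun x => ∑ j, (innerSL ℝ (EuclideanSpace.basisFun (Fin 3) ℝ j)).smulRight (M j x)) := by
  set b := EuclideanSpace.basisFun (Fin 3) ℝ with hb
  have hwli : LocallyIntegrable w volume := locallyIntegrable_of_memLp_weight_smul h2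
  -- the weak gradient as a continuous linear image of `(M_j)`, hence locally integrable
  have hG : (fun x => ∑ j, (innerSL ℝ (b j)).smulRight (M j x)) =
      fun x => ∑ j, ContinuousLinearMap.smulRightL ℝ (EuclideanSpace ℝ (Fin 3)) (EuclideanSpace ℝ (Fin 3)) (innerSL ℝ (b j)) (M j x) := by
    funext x
    refine Finset.sum_congr rfl fun j _ => ?_
    ext v
    simp only [ContinuousLinearMap.smulRight_apply, ContinuousLinearMap.smulRightL_apply_apply]
  have hGli : LocallyIntegrable (fun x => ∑ j, (innerSL ℝ (b j)).smulRight (M j x)) volume := by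
    rw [hG]
    exact locallyIntegrable_finsetSum (s := Finset.univ)
      (f := fun j x => ContinuousLinearMap.smulRightL ℝ (EuclideanSpace ℝ (Fin 3)) (EuclideanSpace ℝ (Fin 3)) (innerSL ℝ (b j)) (M j x))
      fun j _ => ((ContinuousLinearMap.smulRightL ℝ (EuclideanSpace ℝ (Fin 3)) (EuclideanSpace ℝ (Fin 3))
        (innerSL ℝ (b j))).comp_memLp' (hM j)).locallyIntegrable one_le_two
  refine ⟨hwli.locallyIntegrableOn _, hGli.locallyIntegrableOn _, fun φ v hφ => ?_⟩
  simp only [TopologicalSpace.Opens.coe_top, Measure.restrict_univ]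
  have hφ1 : ContDiff ℝ 1 φ := hφ.contDiff.of_le (by norm_cast)
  have hφc : HasCompactSupport φ := hφ.hasCompactSupport
  have hφcont : Continuous φ := hφ.contDiff.continuous
  have hDφ : ∀ j, Continuous fun x => fderiv ℝ φ x (b j) := fun j =>
    (hφ1.continuous_fderiv one_ne_zero).clm_apply continuous_const
  have hDφc : ∀ j, HasCompactSupport fun x => fderiv ℝ φ x (b j) := fun j => hφc.fderiv_apply (𝕜 := ℝ) (b j)
  -- per direction `eⱼ`: the vector identity `∫ (∂ⱼφ) • w = -∫ φ • M_j`
  have hj : ∀ j : Fin 3, (∫ x, fderiv ℝ φ x (b j) • w x) = -∫ x, φ x • M j x := by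
    intro j
    have I1 : Integrable (fun x => fderiv ℝ φ x (b j) • w x) := hwli.integrable_smul_left_of_hasCompactSupport (hDφ j) (hDφc j)
    have I2 : Integrable (fun x => φ x • M j x) :=
      ((hM j).locallyIntegrable one_le_two).integrable_smul_left_of_hasCompactSupport hφcont hφc
    refine ext_inner_left ℝ fun a => ?_
    -- test field `ψ = φ • a`
    have hψ1 : ContDiff ℝ 1 fun x => φ x • a := hφ1.smul contDiff_const
    have hψc : HasCompactSupport fun x => φ x • a := by
      have h : HasCompactSupport (φ • fun _ : EuclideanSpace ℝ (Fin 3) => a) := hφc.smul_right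
      exact h
    have hDψ : ∀ x, fderiv ℝ (fun y => φ y • a) x (b j) = fderiv ℝ φ x (b j) • a := fun x => by
      rw [fderiv_smul_const (hφ1.differentiable one_ne_zero x), ContinuousLinearMap.smulRight_apply]
    have h := hprof j (fun x => φ x • a) hψ1 hψc
    rw [← integral_inner I1, inner_neg_right, ← integral_inner I2]
    have e1 : (∫ x, ⟪a, fderiv ℝ φ x (b j) • w x⟫_ℝ) = ∫ x, ⟪w x, fderiv ℝ (fun y => φ y • a) x (b j)⟫_ℝ :=
      integral_congr_ae (ae_of_all _ fun x => by
        show ⟪a, fderiv ℝ φ x (b j) • w x⟫_ℝ = ⟪w x, fderiv ℝ (fun y => φ y • a) x (b j)⟫_ℝ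
        rw [hDψ x, real_inner_smul_right, real_inner_smul_right, real_inner_comm])
    have e2 : (∫ x, ⟪M j x, φ x • a⟫_ℝ) = ∫ x, ⟪a, φ x • M j x⟫_ℝ :=
      integral_congr_ae (ae_of_all _ fun x => by
        show ⟪M j x, φ x • a⟫_ℝ = ⟪a, φ x • M j x⟫_ℝ
        rw [real_inner_smul_right, real_inner_smul_right, real_inner_comm])
    rw [e1, h, e2]
  -- assemble over `v = Σⱼ ⟪eⱼ, v⟫ eⱼ`
  have hv : ∀ x, fderiv ℝ φ x v = ∑ j, ⟪b j, v⟫_ℝ * fderiv ℝ φ x (b j) := fun x => by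
    conv_lhs => rw [← b.sum_repr' v]
    rw [map_sum]
    refine Finset.sum_congr rfl fun j _ => ?_
    rw [map_smul, smul_eq_mul]
  have hGv : ∀ x, (∑ j, (innerSL ℝ (b j)).smulRight (M j x)) v = ∑ j, ⟪b j, v⟫_ℝ • M j x := fun x => by
    simp only [FunLike.coe_sum, Finset.sum_apply, ContinuousLinearMap.smulRight_apply, innerSL_apply_apply]
  have I1 : ∀ j, Integrable (fun x => ⟪b j, v⟫_ℝ • (fderiv ℝ φ x (b j) • w x)) := fun j => by
    have h := (hwli.integrable_smul_left_of_hasCompactSupport (hDφ j) (hDφc j)).smul (⟪b j, v⟫_ℝ)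
    exact h
  have I2 : ∀ j, Integrable (fun x => ⟪b j, v⟫_ℝ • (φ x • M j x)) := fun j => by
    have h := (((hM j).locallyIntegrable one_le_two).integrable_smul_left_of_hasCompactSupport hφcont hφc).smul (⟪b j, v⟫_ℝ)
    exact h
  calc (∫ x, fderiv ℝ φ x v • w x) = ∫ x, ∑ j, ⟪b j, v⟫_ℝ • (fderiv ℝ φ x (b j) • w x) := by
        refine integral_congr_ae (ae_of_all _ fun x => ?_)
        show fderiv ℝ φ x v • w x = ∑ j, ⟪b j, v⟫_ℝ • (fderiv ℝ φ x (b j) • w x)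
        rw [hv x, Finset.sum_smul]
        refine Finset.sum_congr rfl fun j _ => ?_
        rw [smul_smul]
    _ = ∑ j, ⟪b j, v⟫_ℝ • ∫ x, fderiv ℝ φ x (b j) • w x := by
        rw [integral_finsetSum _ (fun j _ => I1 j)]
        refine Finset.sum_congr rfl fun j _ => ?_
        rw [integral_smul]
    _ = ∑ j, ⟪b j, v⟫_ℝ • (-∫ x, φ x • M j x) := Finset.sum_congr rfl fun j _ => by rw [hj j]
    _ = -∫ x, φ x • (∑ j, (innerSL ℝ (b j)).smulRight (M j x)) v := by
        simp_rw [hGv, smul_neg, Finset.sum_neg_distrib]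
        congr 1
        have e : ∀ j, ⟪b j, v⟫_ℝ • (∫ x, φ x • M j x) = ∫ x, ⟪b j, v⟫_ℝ • (φ x • M j x) := fun j =>
          (integral_smul _ _).symm
        simp_rw [e]
        rw [← integral_finsetSum _ (fun j _ => I2 j)]
        refine integral_congr_ae (ae_of_all _ fun x => ?_)
        show ∑ j, ⟪b j, v⟫_ℝ • (φ x • M j x) = φ x • ∑ j, ⟪b j, v⟫_ℝ • M j x
        rw [Finset.smul_sum]
        refine Finset.sum_congr rfl fun j _ => ?_
        rw [smul_comm]
    _ = -∫ x, φ x • (∑ j, (innerSL ℝ (b j)).smulRight (M j x)) v := rfl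

/-! ## §3 Uniqueness up to an additive constant -/

/-- **Two weak-class profiles with the same gradient data differ a.e. by a constant.** If `w₁, w₂` both have
`(1+|x|)^{-3/2} wᵢ ∈ L²` and `∫⟪wᵢ, ∂ⱼψ⟫ = −∫⟪M_j, ψ⟫` on `C¹_c`, then `w₁ − w₂` has weak gradient zero, hence is a.e. a constant
vector (which `weakProfile_unique` shows to be `0`). [folklore] -/
theorem weakProfile_unique_up_to_const {w₁ w₂ : EuclideanSpace ℝ (Fin 3) → EuclideanSpace ℝ (Fin 3)}
    {M : Fin 3 → EuclideanSpace ℝ (Fin 3) → EuclideanSpace ℝ (Fin 3)}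
    (h₁ : MemLp (fun x => ((1 : ℝ) + ‖x‖) ^ (-(3 / 2 : ℝ)) • w₁ x) 2 volume)
    (h₂ : MemLp (fun x => ((1 : ℝ) + ‖x‖) ^ (-(3 / 2 : ℝ)) • w₂ x) 2 volume)
    (hprof₁ : ∀ (j : Fin 3) (ψ : EuclideanSpace ℝ (Fin 3) → EuclideanSpace ℝ (Fin 3)), ContDiff ℝ 1 ψ → HasCompactSupport ψ →
      ∫ x, ⟪w₁ x, fderiv ℝ ψ x (EuclideanSpace.basisFun (Fin 3) ℝ j)⟫_ℝ = -∫ x, ⟪M j x, ψ x⟫_ℝ)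
    (hprof₂ : ∀ (j : Fin 3) (ψ : EuclideanSpace ℝ (Fin 3) → EuclideanSpace ℝ (Fin 3)), ContDiff ℝ 1 ψ → HasCompactSupport ψ →
      ∫ x, ⟪w₂ x, fderiv ℝ ψ x (EuclideanSpace.basisFun (Fin 3) ℝ j)⟫_ℝ = -∫ x, ⟪M j x, ψ x⟫_ℝ) :
    ∃ c : EuclideanSpace ℝ (Fin 3), (fun x => w₁ x - w₂ x) =ᵐ[volume] fun _ => c := by
  -- local integrability and integrability against compactly supported continuous fields
  have hli₁ := locallyIntegrable_of_memLp_weight_smul h₁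
  have hli₂ := locallyIntegrable_of_memLp_weight_smul h₂
  have hint : ∀ {w : EuclideanSpace ℝ (Fin 3) → EuclideanSpace ℝ (Fin 3)}, LocallyIntegrable w volume →
      ∀ {g : EuclideanSpace ℝ (Fin 3) → EuclideanSpace ℝ (Fin 3)}, Continuous g → HasCompactSupport g →
      Integrable (fun x => ⟪w x, g x⟫_ℝ) := by
    intro w hw g hg hgc
    have h := (hw.integrable_smul_left_of_hasCompactSupport hg.norm hgc.norm).norm
    refine h.mono' (hw.aestronglyMeasurable.inner hg.aestronglyMeasurable) (ae_of_all _ fun x => ?_)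
    rw [Real.norm_eq_abs, norm_smul, norm_norm, mul_comm]
    exact abs_real_inner_le_norm _ _
  -- the difference is a weak-class profile with gradient data `0`
  have hd2 : MemLp (fun x => ((1 : ℝ) + ‖x‖) ^ (-(3 / 2 : ℝ)) • (w₁ x - w₂ x)) 2 volume :=
    (h₁.sub h₂).ae_eq (ae_of_all _ fun x => by
      show ((1 : ℝ) + ‖x‖) ^ (-(3 / 2 : ℝ)) • w₁ x - ((1 : ℝ) + ‖x‖) ^ (-(3 / 2 : ℝ)) • w₂ x =
        ((1 : ℝ) + ‖x‖) ^ (-(3 / 2 : ℝ)) • (w₁ x - w₂ x)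
      rw [smul_sub])
  have hprofd : ∀ (j : Fin 3) (ψ : EuclideanSpace ℝ (Fin 3) → EuclideanSpace ℝ (Fin 3)), ContDiff ℝ 1 ψ → HasCompactSupport ψ →
      ∫ x, ⟪w₁ x - w₂ x, fderiv ℝ ψ x (EuclideanSpace.basisFun (Fin 3) ℝ j)⟫_ℝ =
        -∫ x, ⟪(fun (_ : Fin 3) (_ : EuclideanSpace ℝ (Fin 3)) => (0 : EuclideanSpace ℝ (Fin 3))) j x, ψ x⟫_ℝ := by
    intro j ψ hψ hψc
    have hDψ : Continuous fun x => fderiv ℝ ψ x (EuclideanSpace.basisFun (Fin 3) ℝ j) :=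
      (hψ.continuous_fderiv one_ne_zero).clm_apply continuous_const
    have hDψc : HasCompactSupport fun x => fderiv ℝ ψ x (EuclideanSpace.basisFun (Fin 3) ℝ j) :=
      hψc.fderiv_apply (𝕜 := ℝ) _
    have I1 := hint hli₁ hDψ hDψc
    have I2 := hint hli₂ hDψ hDψc
    have e : (∫ x, ⟪w₁ x - w₂ x, fderiv ℝ ψ x (EuclideanSpace.basisFun (Fin 3) ℝ j)⟫_ℝ) =
        (∫ x, ⟪w₁ x, fderiv ℝ ψ x (EuclideanSpace.basisFun (Fin 3) ℝ j)⟫_ℝ) -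
          ∫ x, ⟪w₂ x, fderiv ℝ ψ x (EuclideanSpace.basisFun (Fin 3) ℝ j)⟫_ℝ := by
      rw [← integral_sub I1 I2]
      exact integral_congr_ae (ae_of_all _ fun x => by
        show ⟪w₁ x - w₂ x, _⟫_ℝ = _
        rw [inner_sub_left])
    rw [e, hprof₁ j ψ hψ hψc, hprof₂ j ψ hψ hψc]
    simp
  have hW := hasWeakGradient_of_weakProfile hd2 (fun _ => MemLp.zero') hprofd
  have hG0 : (fun x : EuclideanSpace ℝ (Fin 3) => ∑ j : Fin 3, (innerSL ℝ (EuclideanSpace.basisFun (Fin 3) ℝ j)).smulRight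
      ((fun (_ : Fin 3) (_ : EuclideanSpace ℝ (Fin 3)) => (0 : EuclideanSpace ℝ (Fin 3))) j x)) =
      fun _ => (0 : EuclideanSpace ℝ (Fin 3) →L[ℝ] EuclideanSpace ℝ (Fin 3)) := by
    funext x
    refine Finset.sum_eq_zero fun j _ => ?_
    ext v
    simp
  rw [hG0] at hW
  exact ScenarioCensus.ModulationGate.DissipationProof.ae_eq_const_of_hasWeakGradient_zero hW

/-! ## §4 The weight is not square-integrable: the additive constant vanishes -/

/-- Dyadic shells `B(0,2^{k+1}) \\ B(0,2^k)` with `k < l` are disjoint. [folklore] -/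
theorem shell_disjoint_of_lt {k l : ℕ} (h : k < l) :
    Disjoint (ball (0 : EuclideanSpace ℝ (Fin 3)) ((2 : ℝ) ^ (k + 1)) \ ball 0 ((2 : ℝ) ^ k))
      (ball (0 : EuclideanSpace ℝ (Fin 3)) ((2 : ℝ) ^ (l + 1)) \ ball 0 ((2 : ℝ) ^ l)) := by
  refine Set.disjoint_left.2 fun x hxk hxl => ?_
  have h1 : ‖x‖ < (2 : ℝ) ^ (k + 1) := by simpa using hxk.1
  have h2 : ¬ ‖x‖ < (2 : ℝ) ^ l := by simpa using hxl.2
  exact h2 (h1.trans_le (pow_le_pow_right₀ one_le_two h))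

/-- The dyadic shells are pairwise disjoint. [folklore] -/
theorem shell_disjoint : Set.PairwiseDisjoint (Set.univ : Set ℕ)
    (fun k : ℕ => ball (0 : EuclideanSpace ℝ (Fin 3)) ((2 : ℝ) ^ (k + 1)) \ ball 0 ((2 : ℝ) ^ k)) := by
  intro k _ l _ hkl
  rcases lt_or_gt_of_ne hkl with h | h
  · exact shell_disjoint_of_lt h
  · exact (shell_disjoint_of_lt h).symm

/-- Volume of a dyadic shell: `|B(0,2^{k+1}) \\ B(0,2^k)| = 7·2^{3k}·|B(0,1)|`. [folklore] -/
theorem shell_measure (k : ℕ) :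
    volume (ball (0 : EuclideanSpace ℝ (Fin 3)) ((2 : ℝ) ^ (k + 1)) \ ball 0 ((2 : ℝ) ^ k)) =
      ENNReal.ofReal (7 * 2 ^ (3 * k)) * volume (ball (0 : EuclideanSpace ℝ (Fin 3)) 1) := by
  have hsub : ball (0 : EuclideanSpace ℝ (Fin 3)) ((2 : ℝ) ^ k) ⊆ ball 0 ((2 : ℝ) ^ (k + 1)) :=
    ball_subset_ball (pow_le_pow_right₀ one_le_two (Nat.le_succ k))
  rw [measure_sdiff hsub measurableSet_ball.nullMeasurableSet measure_ball_lt_top.ne,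
    Measure.addHaar_ball_of_pos volume 0 (by positivity : (0:ℝ) < 2 ^ (k + 1)),
    Measure.addHaar_ball_of_pos volume 0 (by positivity : (0:ℝ) < 2 ^ k), finrank_euclideanSpace_fin,
    ← ENNReal.sub_mul (fun _ _ => measure_ball_lt_top.ne), ← ENNReal.ofReal_sub _ (by positivity)]
  congr 2
  ring

/-- **`∫ (1+|x|)^{-3} dx = ∞` on `ℝ³`**: each dyadic shell contributes at least `(7/64)|B(0,1)|`. [folklore] -/
theorem lintegral_weight_sq_eq_top :
    ∫⁻ x : EuclideanSpace ℝ (Fin 3), ENNReal.ofReal (((1 : ℝ) + ‖x‖) ^ (-(3 : ℝ))) = ⊤ := by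
  set v1 := volume (ball (0 : EuclideanSpace ℝ (Fin 3)) 1) with hv1
  have hv1pos : v1 ≠ 0 := (measure_ball_pos volume (0 : EuclideanSpace ℝ (Fin 3)) one_pos).ne'
  have hv1top : v1 ≠ ⊤ := measure_ball_lt_top.ne
  set A : ℕ → Set (EuclideanSpace ℝ (Fin 3)) := fun k => ball 0 ((2 : ℝ) ^ (k + 1)) \ ball 0 ((2 : ℝ) ^ k) with hA
  have hAm : ∀ k, MeasurableSet (A k) := fun k => measurableSet_ball.diff measurableSet_ball
  -- on each shell the integral is at least `7/64 · v1`
  have hshell : ∀ k, ENNReal.ofReal (7 / 64) * v1 ≤ ∫⁻ x in A k, ENNReal.ofReal (((1 : ℝ) + ‖x‖) ^ (-(3 : ℝ))) := by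
    intro k
    have hle : ∀ x ∈ A k, ENNReal.ofReal ((1 / (2 : ℝ) ^ (3 * k + 6))) ≤ ENNReal.ofReal (((1 : ℝ) + ‖x‖) ^ (-(3 : ℝ))) := by
      intro x hx
      have hxlt : ‖x‖ < (2 : ℝ) ^ (k + 1) := by simpa [hA] using hx.1
      refine ENNReal.ofReal_le_ofReal ?_
      have h1 : (1 : ℝ) + ‖x‖ ≤ (2 : ℝ) ^ (k + 2) := by
        have : (1 : ℝ) ≤ 2 ^ (k + 1) := one_le_pow₀ one_le_two
        calc (1 : ℝ) + ‖x‖ ≤ 2 ^ (k + 1) + 2 ^ (k + 1) := by linarith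
          _ = 2 ^ (k + 2) := by ring
      have hpos : (0 : ℝ) < 1 + ‖x‖ := by positivity
      rw [Real.rpow_neg hpos.le, show (3 : ℝ) = ((3 : ℕ) : ℝ) by norm_num, Real.rpow_natCast, one_div]
      refine inv_anti₀ (by positivity) ?_
      calc ((1 : ℝ) + ‖x‖) ^ 3 ≤ ((2 : ℝ) ^ (k + 2)) ^ 3 := pow_le_pow_left₀ hpos.le h1 3
        _ = 2 ^ (3 * k + 6) := by rw [← pow_mul]; ring_nf
    calc ENNReal.ofReal (7 / 64) * v1 = ENNReal.ofReal (1 / (2 : ℝ) ^ (3 * k + 6)) * (ENNReal.ofReal (7 * 2 ^ (3 * k)) * v1) := by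
          rw [← mul_assoc, ← ENNReal.ofReal_mul (by positivity)]
          congr 2
          field_simp
          ring
      _ = ENNReal.ofReal (1 / (2 : ℝ) ^ (3 * k + 6)) * volume (A k) := by rw [hA, shell_measure k]
      _ = ∫⁻ _ in A k, ENNReal.ofReal (1 / (2 : ℝ) ^ (3 * k + 6)) := (setLIntegral_const _ _).symm
      _ ≤ ∫⁻ x in A k, ENNReal.ofReal (((1 : ℝ) + ‖x‖) ^ (-(3 : ℝ))) :=
          setLIntegral_mono' (hAm k) fun x hx => hle x hx
  -- sum over `K` shells
  have hsum : ∀ K : ℕ, (K : ℝ≥0∞) * (ENNReal.ofReal (7 / 64) * v1) ≤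
      ∫⁻ x : EuclideanSpace ℝ (Fin 3), ENNReal.ofReal (((1 : ℝ) + ‖x‖) ^ (-(3 : ℝ))) := by
    intro K
    have hdisj : Set.PairwiseDisjoint (↑(Finset.range K) : Set ℕ) A := fun k _ l _ hkl =>
      shell_disjoint (Set.mem_univ k) (Set.mem_univ l) hkl
    calc (K : ℝ≥0∞) * (ENNReal.ofReal (7 / 64) * v1) = ∑ k ∈ Finset.range K, ENNReal.ofReal (7 / 64) * v1 := by
          rw [Finset.sum_const, Finset.card_range, nsmul_eq_mul]
      _ ≤ ∑ k ∈ Finset.range K, ∫⁻ x in A k, ENNReal.ofReal (((1 : ℝ) + ‖x‖) ^ (-(3 : ℝ))) := Finset.sum_le_sum fun k _ => hshell k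
      _ = ∫⁻ x in ⋃ k ∈ Finset.range K, A k, ENNReal.ofReal (((1 : ℝ) + ‖x‖) ^ (-(3 : ℝ))) :=
          (lintegral_biUnion_finset hdisj (fun k _ => hAm k) _).symm
      _ ≤ _ := setLIntegral_le_lintegral _ _
  by_contra hne
  have hc : ENNReal.ofReal (7 / 64) * v1 ≠ 0 := mul_ne_zero (by rw [Ne, ENNReal.ofReal_eq_zero, not_le]; norm_num) hv1pos
  obtain ⟨K, hK⟩ := ENNReal.exists_nat_mul_gt hc hne
  exact absurd (hsum K) (not_le.2 hK)

/-- **A nonzero constant field is not in the weighted `L²` class**: `(1+|x|)^{-3/2} c ∈ L²(ℝ³)` forces `c = 0`. [folklore] -/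
theorem eq_zero_of_memLp_weight_smul_const {c : EuclideanSpace ℝ (Fin 3)}
    (h : MemLp (fun x : EuclideanSpace ℝ (Fin 3) => ((1 : ℝ) + ‖x‖) ^ (-(3 / 2 : ℝ)) • c) 2 volume) : c = 0 := by
  by_contra hc
  have hfin : ∫⁻ x : EuclideanSpace ℝ (Fin 3), ‖((1 : ℝ) + ‖x‖) ^ (-(3 / 2 : ℝ)) • c‖ₑ ^ (2 : ℝ) < ⊤ := by
    have h2 := h.2
    rw [eLpNorm_lt_top_iff_lintegral_rpow_enorm_lt_top two_ne_zero ENNReal.ofNat_ne_top, ENNReal.toReal_ofNat] at h2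
    exact h2
  have hpt : ∀ x : EuclideanSpace ℝ (Fin 3), ‖((1 : ℝ) + ‖x‖) ^ (-(3 / 2 : ℝ)) • c‖ₑ ^ (2 : ℝ) =
      ENNReal.ofReal (‖c‖ ^ 2) * ENNReal.ofReal (((1 : ℝ) + ‖x‖) ^ (-(3 : ℝ))) := by
    intro x
    have h0 : (0 : ℝ) ≤ 1 + ‖x‖ := by positivity
    have hr : ‖((1 : ℝ) + ‖x‖) ^ (-(3 / 2 : ℝ)) • c‖ ^ 2 = ‖c‖ ^ 2 * ((1 : ℝ) + ‖x‖) ^ (-(3 : ℝ)) := by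
      rw [norm_smul, Real.norm_eq_abs, abs_of_pos (weight_pos x), mul_pow,
        ← Real.rpow_natCast (((1 : ℝ) + ‖x‖) ^ (-(3 / 2 : ℝ))) 2, ← Real.rpow_mul h0, mul_comm]
      norm_num
    rw [← ofReal_norm, ENNReal.ofReal_rpow_of_nonneg (norm_nonneg _) (by norm_num), Real.rpow_two, hr,
      ENNReal.ofReal_mul (sq_nonneg _)]
  have hc2 : ENNReal.ofReal (‖c‖ ^ 2) ≠ 0 := by
    rw [Ne, ENNReal.ofReal_eq_zero, not_le]
    exact pow_pos (norm_pos_iff.2 hc) 2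
  have heq : ∫⁻ x : EuclideanSpace ℝ (Fin 3), ‖((1 : ℝ) + ‖x‖) ^ (-(3 / 2 : ℝ)) • c‖ₑ ^ (2 : ℝ) = ⊤ := by
    simp_rw [hpt]
    rw [lintegral_const_mul' _ _ ENNReal.ofReal_ne_top, lintegral_weight_sq_eq_top, ENNReal.mul_top hc2]
  exact absurd heq hfin.ne

/-- **The weak-class profile is unique.** Two weak-class profiles (`(1+|x|)^{-3/2} wᵢ ∈ L²`) with the same distributional
gradient data agree almost everywhere. [folklore] -/
theorem weakProfile_unique {w₁ w₂ : EuclideanSpace ℝ (Fin 3) → EuclideanSpace ℝ (Fin 3)}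
    {M : Fin 3 → EuclideanSpace ℝ (Fin 3) → EuclideanSpace ℝ (Fin 3)}
    (h₁ : MemLp (fun x => ((1 : ℝ) + ‖x‖) ^ (-(3 / 2 : ℝ)) • w₁ x) 2 volume)
    (h₂ : MemLp (fun x => ((1 : ℝ) + ‖x‖) ^ (-(3 / 2 : ℝ)) • w₂ x) 2 volume)
    (hprof₁ : ∀ (j : Fin 3) (ψ : EuclideanSpace ℝ (Fin 3) → EuclideanSpace ℝ (Fin 3)), ContDiff ℝ 1 ψ → HasCompactSupport ψ →
      ∫ x, ⟪w₁ x, fderiv ℝ ψ x (EuclideanSpace.basisFun (Fin 3) ℝ j)⟫_ℝ = -∫ x, ⟪M j x, ψ x⟫_ℝ)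
    (hprof₂ : ∀ (j : Fin 3) (ψ : EuclideanSpace ℝ (Fin 3) → EuclideanSpace ℝ (Fin 3)), ContDiff ℝ 1 ψ → HasCompactSupport ψ →
      ∫ x, ⟪w₂ x, fderiv ℝ ψ x (EuclideanSpace.basisFun (Fin 3) ℝ j)⟫_ℝ = -∫ x, ⟪M j x, ψ x⟫_ℝ) :
    w₁ =ᵐ[volume] w₂ := by
  obtain ⟨c, hc⟩ := weakProfile_unique_up_to_const h₁ h₂ hprof₁ hprof₂
  have hcm : MemLp (fun x : EuclideanSpace ℝ (Fin 3) => ((1 : ℝ) + ‖x‖) ^ (-(3 / 2 : ℝ)) • c) 2 volume := by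
    have hd : MemLp (fun x => ((1 : ℝ) + ‖x‖) ^ (-(3 / 2 : ℝ)) • (w₁ x - w₂ x)) 2 volume :=
      (h₁.sub h₂).ae_eq (ae_of_all _ fun x => by
        show ((1 : ℝ) + ‖x‖) ^ (-(3 / 2 : ℝ)) • w₁ x - ((1 : ℝ) + ‖x‖) ^ (-(3 / 2 : ℝ)) • w₂ x =
          ((1 : ℝ) + ‖x‖) ^ (-(3 / 2 : ℝ)) • (w₁ x - w₂ x)
        rw [smul_sub])
    exact hd.ae_eq (hc.mono fun x hx => by simp only [hx])
  have hc0 : c = 0 := eq_zero_of_memLp_weight_smul_const hcm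
  filter_upwards [hc] with x hx
  rw [hc0] at hx
  exact sub_eq_zero.1 hx

end SeqCore

end NearSaturationNearMaximiser

end Summit.NavierStokesRegularity.NavierStokesRegularity.Theorems

end
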